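import Summits.Ventures.LatticeQCDFlow.Scaling.ReplicaExchangeModeTorpid
import Summits.Ventures.LatticeQCDFlow.Scaling.ReplicaExchangeBareSampler

/-!
HONEST FRAMING: exact (Metropolis-corrected) sampling algorithms for lattice gauge theory; figures
of merit are autocorrelation/cost numbers at stated couplings and volumes; no continuum-physics
claim.

# ExchangeSchemeHandoverCeiling — THE HANDOVER IDENTITY AND THE LINEAR LAW: FOR `P = t·Q + (1−t)·Upd_w` WITH ANY
# UPDATE WEIGHTS `w` AND ANY EXCHANGE MOVE `Q` PRESERVING THE NUMBER OF REPLICAS IN A SECTOR `A`, THE EXCHANGE MOVE'S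
# DIRICHLET FORM OF THE COLD SECTOR COUNT EQUALS THAT OF THE HOT REPLICA'S SECTOR INDICATOR (= THE HANDOVER FLOW
# `η`); WITH SECTOR-FROZEN COLD REPLICAS `Gap(P) ≤ t·η/(K·v) ≤ t·min{μ_0(A), μ_0(Aᶜ)}/(K·v)` AND
# `Gap(P) ≤ (1−t)·w_0·Q_0(A,Aᶜ)/(K·v)` — ORDER `K` AT BEST FOR EVERY SCHEME AND EVERY ALLOCATION OF UPDATES
# (lean-2 GEN-20, ours)

Venture-side (OURS).  Cell `lqcd-flow` (pub-lqcd), unit `pub-lqcd-lean-2-g20`, 2026-08-25.  Chapter H of the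
replica-exchange scaling series; the third universal test function after the sector count of
`ExchangeSchemeSectorCeiling` (order `K²` with uniform update weights) and the linear profile of
`AdjacentSchemeDiffusiveCeiling` (order `K³` for adjacent exchanges).  State space `Fin (K+1) → S` (`S` finite), law
`π̃ = ⊗_k μ_k` (`tensorFun μ`, positive probability vectors), replica updates `Upd_w = prodKernel w M` (replica `k` is
chosen with probability `w_k` and makes one `M_k`-step; `M_k` row-stochastic, `μ_k`-reversible; `w` a probability
vector — uniform `1/(K+1)` is the usual sampler, but a cheap hot sampler, e.g. a trained flow at the coarsest level,
may be consulted far more often), and an EXCHANGE MOVE `Q`: any row-stochastic `π̃`-reversible kernel with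
`Q(x,y) ≠ 0 ⇒ #{k : y_k ∈ A} = #{k : x_k ∈ A}` (swaps on any graph, sector-preserving maps between couplings,
multi-replica permutations, any acceptance rule).  `P(x,y) = t·Q(x,y) + (1−t)·Upd_w(x,y)`; `Q_k(A,Aᶜ) =
edgeMeasure (μ k) (M k) A Aᶜ`; `f_A^{(ν)} = 1_{Aᶜ} − ν(Aᶜ)` is the Literature's `bottleneckTestFun ν A`.

## What is proved

* §1 `dirichletForm_congr_support`, `edgeMeasure_le_mass` (`Q(B,C) ≤ π(B)`), and the weighted scheme is
  row-stochastic, `π̃`-reversible, with `𝓔_P = t𝓔_Q + (1−t)𝓔_{Upd_w}`.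
* §2 the COLD SECTOR COUNT `G(x) = Σ_{k≠0} f_A^{(μ_k)}(x_k)`: centred, `‖G‖²_π̃ = Σ_{k≠0} μ_k(A)μ_k(Aᶜ)`,
  `𝓔_{Upd_w}(G) = Σ_{k≠0} w_kQ_k(A,Aᶜ)`, `coldCount_sub_eq`.
* §3 **`exchange_dirichletForm_coldCount` (HANDOVER IDENTITY): `𝓔_Q(G) = 𝓔_Q(x ↦ f_A^{(μ_0)}(x_0))`** — a
  count-preserving move changes the cold count exactly when it changes the hot replica's sector, by the opposite unit;
  **`exchange_dirichletForm_hotIndicator`: `𝓔_Q(x ↦ f_A^{(μ_0)}(x_0)) = η`**, the `Q`-flow from `{x_0 ∈ A}` to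
  `{x_0 ∉ A}` (the stationary HANDOVER FLOW); `handoverFlow_le_hot` / `_compl` (`η ≤ μ_0(A)`, `η ≤ μ_0(Aᶜ)`).
* §4 **`handover_spectralGap_le`**: `Gap(P) ≤ (t·η + (1−t)Σ_{k≠0} w_kQ_k(A,Aᶜ))/Σ_{k≠0} μ_k(A)μ_k(Aᶜ)`;
  **`weightedScheme_spectralGap_le_sectorCount`** (weighted form of `ExchangeSchemeSectorCeiling`):
  `Gap(P) ≤ (1−t)Σ_k w_kQ_k(A,Aᶜ)/Σ_k μ_k(A)μ_k(Aᶜ)`; with sector-frozen cold replicas (`Q_k(A,Aᶜ) = 0`,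
  `μ_k(A)μ_k(Aᶜ) ≥ v > 0` for `k ≠ 0`, `K ≥ 1`): **`handoverFrozen_spectralGap_le`** `Gap ≤ t·η/(K·v)`,
  **`handoverFrozen_spectralGap_le_linear` (THE LINEAR LAW)** `Gap ≤ t·min{μ_0(A), μ_0(Aᶜ)}/(K·v)`,
  **`weightedSchemeFrozen_spectralGap_le_hot`** `Gap ≤ (1−t)·w_0·Q_0(A,Aᶜ)/(K·v)`.

Reading (no numerics implied): a sector label reaches the `K` cold replicas only by HANDOVER — an exchange move that
changes the tunnelling replica's own sector —, at most one per exchange step, and fresh labels are minted only by the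
hot replica's own updates, at most `w_0·Q_0(A,Aᶜ)` per update step: `K` frozen clients share both, so no exchange
scheme and no allocation of update effort relaxes faster than order `K` sampler steps; uniform weights cost a further
factor `K+1` (`ExchangeSchemeSectorCeiling`), adjacent-only exchange a further factor of order `K`
(`AdjacentSchemeDiffusiveCeiling`).  NOT CLAIMED: floors, or that some scheme attains order `K`; continuous
configuration spaces; anything measured.  Literature grade (cell rule): KNOWN MECHANISM (test-function ceilings,
Levin–Peres–Wilmer §13.2), NEW TYPING (the handover identity; update weights); nothing cited as a fact; no new bib keys.
-/

noncomputable section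

open Finset Function
open Literature.Probability.MarkovChains

namespace Summit.Ventures.LatticeQCDFlow.Scaling

/-! ## §1 Generic tools and the weighted scheme -/

section Generic
variable {X : Type*} [Fintype X]

/-- **A Dirichlet form only sees the squared increments on the support of its kernel:** if
`(F x − F y)² = (G x − G y)²` whenever `Q(x,y) ≠ 0`, then `𝓔_Q(F) = 𝓔_Q(G)`. [ours] -/
theorem dirichletForm_congr_support (π : X → ℝ) (Q : Matrix X X ℝ) {F G : X → ℝ}
    (h : ∀ x y, Q x y ≠ 0 → (F x - F y) ^ 2 = (G x - G y) ^ 2) :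
    dirichletForm π Q F = dirichletForm π Q G := by
  unfold dirichletForm
  congr 1
  refine sum_congr rfl fun x _ => sum_congr rfl fun y _ => ?_
  by_cases hq : Q x y = 0
  · rw [hq, mul_zero, zero_mul, zero_mul]
  · rw [h x y hq]

variable [DecidableEq X]

/-- **Flows are bounded by masses:** `Q(B,C) = Σ_{x∈B,y∈C} π(x)P(x,y) ≤ π(B)` for `π ≥ 0` and row-stochastic `P`.
[folklore] -/
theorem edgeMeasure_le_mass {π : X → ℝ} (hπ0 : ∀ x, 0 ≤ π x) {P : X → X → ℝ} (hP : IsRowStochastic P)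
    (B C : Finset X) : edgeMeasure π P B C ≤ ∑ x ∈ B, π x := by
  rw [← edgeMeasure_univ_right hP π B, ← edgeMeasure_add_compl_right π P B C]
  exact le_add_of_nonneg_right (edgeMeasure_nonneg hπ0 hP.1 B Cᶜ)

end Generic

variable {S : Type*} [Fintype S] [DecidableEq S] {K : ℕ} {μ : Fin (K + 1) → S → ℝ}
  {M : Fin (K + 1) → S → S → ℝ} {w : Fin (K + 1) → ℝ} {t : ℝ}
  {Q : Matrix (Fin (K + 1) → S) (Fin (K + 1) → S) ℝ}

/-- The weighted scheme `t·Q + (1−t)·prodKernel w M` is a transition matrix (`0 ≤ t ≤ 1`, `w` a probability vector,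
`Q` and every `M_k` row-stochastic). [ours] -/
theorem weightedScheme_isRowStochastic (hQ : IsRowStochastic Q) (hM : ∀ k, IsRowStochastic (M k))
    (hw0 : ∀ k, 0 ≤ w k) (hw1 : ∑ k, w k = 1) (ht0 : 0 ≤ t) (ht1 : t ≤ 1) :
    IsRowStochastic (fun x y : Fin (K + 1) → S => t * Q x y + (1 - t) * prodKernel w M x y) := by
  have hU := prodKernel_isRowStochastic M w hw0 hw1 hM
  refine ⟨fun x y => add_nonneg (mul_nonneg ht0 (hQ.1 x y)) (mul_nonneg (by linarith) (hU.1 x y)), fun x => ?_⟩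
  simp only
  rw [Finset.sum_add_distrib, ← Finset.mul_sum, ← Finset.mul_sum, hQ.2 x, hU.2 x]
  ring

omit [Fintype S] in
/-- The weighted scheme is in detailed balance with the product law (`Q` `π̃`-reversible, `M_k` `μ_k`-reversible).
[ours] -/
theorem weightedScheme_detailedBalance (hQrev : DetailedBalance (tensorFun μ) Q)
    (hMrev : ∀ k, DetailedBalance (μ k) (M k)) (t : ℝ) :
    DetailedBalance (tensorFun μ) (fun x y : Fin (K + 1) → S => t * Q x y + (1 - t) * prodKernel w M x y) := by
  intro x y
  have h1 := hQrev x y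
  have h2 := prodKernel_detailedBalance (π := μ) hMrev w x y
  simp only
  linear_combination t * h1 + (1 - t) * h2

omit [DecidableEq S] in
/-- The Dirichlet form of the weighted scheme splits: `𝓔_P(F) = t·𝓔_Q(F) + (1−t)·𝓔_{Upd_w}(F)`. [ours] -/
theorem weightedScheme_dirichletForm [DecidableEq S] (t : ℝ) (F : (Fin (K + 1) → S) → ℝ) :
    dirichletForm (tensorFun μ) (fun x y : Fin (K + 1) → S => t * Q x y + (1 - t) * prodKernel w M x y) F
      = t * dirichletForm (tensorFun μ) Q F + (1 - t) * dirichletForm (tensorFun μ) (prodKernel w M) F := by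
  unfold dirichletForm
  rw [← mul_assoc, ← mul_assoc, mul_comm t, mul_comm (1 - t), mul_assoc, mul_assoc, ← mul_add]
  congr 1
  rw [Finset.mul_sum, Finset.mul_sum, ← Finset.sum_add_distrib]
  refine sum_congr rfl fun x _ => ?_
  rw [Finset.mul_sum, Finset.mul_sum, ← Finset.sum_add_distrib]
  exact sum_congr rfl fun y _ => by ring

/-! ## §2 The cold sector count -/

/-- The coordinate means of the cold count vanish (`g_0 = 0`, `g_k = f_A^{(μ_k)}`). [ours] -/
theorem sum_mul_coldCount_coord (A : Finset S) (k : Fin (K + 1)) :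
    ∑ u, μ k u * (if k = 0 then (0 : ℝ) else bottleneckTestFun (μ k) A u) = 0 := by
  by_cases hk : k = 0 <;> simp [hk, sum_mul_bottleneckTestFun]

omit [DecidableEq S] in
/-- **The cold count is centred under `π̃`.** [ours] -/
theorem tensorFun_mean_coldCount [DecidableEq S] (hμ1 : ∀ k, ∑ u, μ k u = 1) (A : Finset S) :
    ∑ x : Fin (K + 1) → S, tensorFun μ x * ∑ k, (if k = 0 then (0 : ℝ) else bottleneckTestFun (μ k) A (x k)) = 0 := by
  rw [sum_tensorFun_mul_additive μ hμ1 (fun k u => if k = 0 then (0 : ℝ) else bottleneckTestFun (μ k) A u)]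
  exact Finset.sum_eq_zero fun k _ => sum_mul_coldCount_coord A k

/-- **`‖G‖²_π̃ = Σ_{k≠0} μ_k(A)μ_k(Aᶜ)`.** [ours] -/
theorem tensorFun_piInner_coldCount (hμ1 : ∀ k, ∑ u, μ k u = 1) (A : Finset S) :
    piInner (tensorFun μ) (fun x => ∑ k, (if k = 0 then (0 : ℝ) else bottleneckTestFun (μ k) A (x k)))
        (fun x => ∑ k, (if k = 0 then (0 : ℝ) else bottleneckTestFun (μ k) A (x k)))
      = ∑ k : Fin (K + 1), (if k = 0 then (0 : ℝ) else (∑ u ∈ A, μ k u) * ∑ u ∈ Aᶜ, μ k u) := by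
  rw [piInner_tensorFun_additive μ hμ1 (fun k u => if k = 0 then (0 : ℝ) else bottleneckTestFun (μ k) A u)
    (fun k => sum_mul_coldCount_coord A k)]
  refine sum_congr rfl fun k _ => ?_
  by_cases hk : k = 0
  · simp [hk, piInner]
  · simp only [hk, if_false]; exact piInner_bottleneckTestFun (hμ1 k) A

/-- **`𝓔_{Upd_w}(G) = Σ_{k≠0} w_k·Q_k(A,Aᶜ)`:** one replica moves at a time, and the hot one does not enter. [ours] -/
theorem prodKernel_dirichletForm_coldCount (hμ1 : ∀ k, ∑ u, μ k u = 1) (hM : ∀ k, IsRowStochastic (M k))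
    (hMrev : ∀ k, DetailedBalance (μ k) (M k)) (w : Fin (K + 1) → ℝ) (A : Finset S) :
    dirichletForm (tensorFun μ) (prodKernel w M)
        (fun x => ∑ k, (if k = 0 then (0 : ℝ) else bottleneckTestFun (μ k) A (x k)))
      = ∑ k, w k * (if k = 0 then (0 : ℝ) else edgeMeasure (μ k) (M k) A Aᶜ) := by
  rw [dirichletForm_prodKernel_additive μ hμ1 w M (fun k u => if k = 0 then (0 : ℝ) else bottleneckTestFun (μ k) A u)]
  refine sum_congr rfl fun k _ => ?_
  by_cases hk : k = 0
  · simp [hk, dirichletForm]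
  · simp only [hk, if_false]; rw [dirichletForm_bottleneckTestFun (hM k) ((hMrev k).isStationary (hM k).2) (hμ1 k) A]

omit [Fintype S] in
/-- **Increments of the cold count:** `G(x) − G(y) = (#{k : y_k ∈ A} − #{k : x_k ∈ A}) − (1_A(y_0) − 1_A(x_0))`.
[ours] -/
theorem coldCount_sub_eq [Fintype S] (hμ1 : ∀ k, ∑ u, μ k u = 1) (A : Finset S) (x y : Fin (K + 1) → S) :
    (∑ k, (if k = 0 then (0 : ℝ) else bottleneckTestFun (μ k) A (x k)))
        - ∑ k, (if k = 0 then (0 : ℝ) else bottleneckTestFun (μ k) A (y k))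
      = ((∑ k, (if y k ∈ A then (1 : ℝ) else 0)) - ∑ k, (if x k ∈ A then (1 : ℝ) else 0))
        - ((if y 0 ∈ A then (1 : ℝ) else 0) - (if x 0 ∈ A then (1 : ℝ) else 0)) := by
  have hterm : ∀ k : Fin (K + 1),
      (if k = 0 then (0 : ℝ) else bottleneckTestFun (μ k) A (x k))
          - (if k = 0 then (0 : ℝ) else bottleneckTestFun (μ k) A (y k))
        = ((if y k ∈ A then (1 : ℝ) else 0) - (if x k ∈ A then (1 : ℝ) else 0))
          - (if k = 0 then ((if y k ∈ A then (1 : ℝ) else 0) - (if x k ∈ A then (1 : ℝ) else 0)) else 0) := by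
    intro k
    by_cases hk : k = 0
    · simp [hk]
    · rw [if_neg hk, if_neg hk, if_neg hk, sub_zero, bottleneckTestFun_eq (hμ1 k), bottleneckTestFun_eq (hμ1 k)]
      split_ifs <;> ring
  rw [← Finset.sum_sub_distrib]
  simp_rw [hterm]
  rw [Finset.sum_sub_distrib, Finset.sum_sub_distrib, Finset.sum_ite_eq' univ (0 : Fin (K + 1)), if_pos (mem_univ _)]

/-! ## §3 The handover identity and the handover flow -/

/-- **HANDOVER IDENTITY: `𝓔_Q(G) = 𝓔_Q(x ↦ f_A^{(μ_0)}(x_0))`** for every exchange move `Q` preserving the number of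
replicas in `A` — such a move changes the cold count exactly when it changes the hot replica's sector, by the
opposite unit. [ours] -/
theorem exchange_dirichletForm_coldCount (hμ1 : ∀ k, ∑ u, μ k u = 1) {A : Finset S}
    (hQA : ∀ x y, Q x y ≠ 0 → ∑ k, (if y k ∈ A then (1 : ℝ) else 0) = ∑ k, (if x k ∈ A then (1 : ℝ) else 0)) :
    dirichletForm (tensorFun μ) Q (fun x => ∑ k, (if k = 0 then (0 : ℝ) else bottleneckTestFun (μ k) A (x k)))
      = dirichletForm (tensorFun μ) Q (fun x => bottleneckTestFun (μ 0) A (x 0)) := by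
  refine dirichletForm_congr_support _ _ fun x y hxy => ?_
  have h := coldCount_sub_eq (μ := μ) hμ1 A x y
  rw [hQA x y hxy, sub_self, zero_sub] at h
  rw [h, bottleneckTestFun_eq (hμ1 0), bottleneckTestFun_eq (hμ1 0)]
  split_ifs <;> ring

omit [DecidableEq S] in
/-- The `π̃`-mass of `{x : x_0 ∈ A}` is `μ_0(A)`. [ours] -/
theorem tensorFun_mass_hotSector [DecidableEq S] (hμ1 : ∀ k, ∑ u, μ k u = 1) (A : Finset S) :
    ∑ x ∈ univ.filter (fun x : Fin (K + 1) → S => x 0 ∈ A), tensorFun μ x = ∑ u ∈ A, μ 0 u := by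
  have h := sum_tensorFun_mul_apply μ hμ1 0 (fun u => if u ∈ A then (1 : ℝ) else 0)
  simp_rw [mul_ite, mul_one, mul_zero] at h
  rwa [← Finset.sum_filter, ← Finset.sum_filter, Finset.filter_mem_eq_inter, Finset.univ_inter] at h

omit [DecidableEq S] in
/-- The `π̃`-mass of `{x : x_0 ∉ A}` is `μ_0(Aᶜ)`. [ours] -/
theorem tensorFun_mass_hotSector_compl [DecidableEq S] (hμ1 : ∀ k, ∑ u, μ k u = 1) (A : Finset S) :
    ∑ x ∈ (univ.filter (fun x : Fin (K + 1) → S => x 0 ∈ A))ᶜ, tensorFun μ x = ∑ u ∈ Aᶜ, μ 0 u := by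
  rw [Finset.compl_filter]
  have e : univ.filter (fun x : Fin (K + 1) → S => ¬x 0 ∈ A) = univ.filter (fun x : Fin (K + 1) → S => x 0 ∈ Aᶜ) :=
    Finset.filter_congr fun x _ => by rw [Finset.mem_compl]
  rw [e, tensorFun_mass_hotSector hμ1 Aᶜ]

omit [DecidableEq S] in
/-- The hot replica's centred sector indicator IS the Literature's test function of the set `{x : x_0 ∈ A}` under
`π̃`. [ours] -/
theorem hotIndicator_eq_bottleneckTestFun [DecidableEq S] (hμ1 : ∀ k, ∑ u, μ k u = 1) (A : Finset S) :
    (fun x : Fin (K + 1) → S => bottleneckTestFun (μ 0) A (x 0))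
      = bottleneckTestFun (tensorFun μ) (univ.filter (fun x : Fin (K + 1) → S => x 0 ∈ A)) := by
  funext x
  unfold bottleneckTestFun
  rw [tensorFun_mass_hotSector hμ1 A, tensorFun_mass_hotSector_compl hμ1 A]
  simp only [Finset.mem_filter, Finset.mem_univ, true_and]

/-- **THE HANDOVER FLOW: `𝓔_Q(x ↦ f_A^{(μ_0)}(x_0)) = η := Σ_{x_0 ∈ A, y_0 ∉ A} π̃(x)Q(x,y)`** — the stationary rate
at which the exchange move hands a configuration of the other sector to the tunnelling replica (`Q` row-stochastic and
`π̃`-reversible). [ours] -/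
theorem exchange_dirichletForm_hotIndicator (hμ1 : ∀ k, ∑ u, μ k u = 1) (hQ : IsRowStochastic Q)
    (hQrev : DetailedBalance (tensorFun μ) Q) (A : Finset S) :
    dirichletForm (tensorFun μ) Q (fun x => bottleneckTestFun (μ 0) A (x 0))
      = edgeMeasure (tensorFun μ) Q (univ.filter (fun x : Fin (K + 1) → S => x 0 ∈ A))
          (univ.filter (fun x : Fin (K + 1) → S => x 0 ∈ A))ᶜ := by
  rw [hotIndicator_eq_bottleneckTestFun hμ1 A]
  exact dirichletForm_bottleneckTestFun hQ (hQrev.isStationary hQ.2) (sum_tensorFun_eq_one μ hμ1) _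

/-- **At most one handover per exchange step, from the hot sector's mass: `η ≤ μ_0(A)`.** [ours] -/
theorem handoverFlow_le_hot (hμ : ∀ k x, 0 < μ k x) (hμ1 : ∀ k, ∑ u, μ k u = 1) (hQ : IsRowStochastic Q)
    (A : Finset S) :
    edgeMeasure (tensorFun μ) Q (univ.filter (fun x : Fin (K + 1) → S => x 0 ∈ A))
        (univ.filter (fun x : Fin (K + 1) → S => x 0 ∈ A))ᶜ ≤ ∑ u ∈ A, μ 0 u := by
  rw [← tensorFun_mass_hotSector hμ1 A]
  exact edgeMeasure_le_mass (fun x => (tensorFun_pos hμ x).le) hQ _ _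

/-- **… and from the other sector's mass: `η ≤ μ_0(Aᶜ)`** (by stationarity, `Q(B,Bᶜ) = Q(Bᶜ,B)`). [ours] -/
theorem handoverFlow_le_hot_compl (hμ : ∀ k x, 0 < μ k x) (hμ1 : ∀ k, ∑ u, μ k u = 1) (hQ : IsRowStochastic Q)
    (hQrev : DetailedBalance (tensorFun μ) Q) (A : Finset S) :
    edgeMeasure (tensorFun μ) Q (univ.filter (fun x : Fin (K + 1) → S => x 0 ∈ A))
        (univ.filter (fun x : Fin (K + 1) → S => x 0 ∈ A))ᶜ ≤ ∑ u ∈ Aᶜ, μ 0 u := by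
  rw [edgeMeasure_compl_comm hQ (hQrev.isStationary hQ.2), ← tensorFun_mass_hotSector_compl hμ1 A]
  exact edgeMeasure_le_mass (fun x => (tensorFun_pos hμ x).le) hQ _ _

/-! ## §4 The ceilings -/

section Ceilings
variable [Nontrivial S] (hμ : ∀ k x, 0 < μ k x) (hμ1 : ∀ k, ∑ u, μ k u = 1) (hM : ∀ k, IsRowStochastic (M k))
  (hMrev : ∀ k, DetailedBalance (μ k) (M k)) (hw0 : ∀ k, 0 ≤ w k) (hw1 : ∑ k, w k = 1) (ht0 : 0 ≤ t) (ht1 : t ≤ 1)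
  (hQ : IsRowStochastic Q) (hQrev : DetailedBalance (tensorFun μ) Q) {A : Finset S}
  (hQA : ∀ x y, Q x y ≠ 0 → ∑ k, (if y k ∈ A then (1 : ℝ) else 0) = ∑ k, (if x k ∈ A then (1 : ℝ) else 0))
include hμ hμ1 hM hMrev hw0 hw1 ht0 ht1 hQ hQrev hQA

/-- **THE HANDOVER CEILING:** for `0 ≤ t ≤ 1`, `w` a probability vector, `Q` row-stochastic, `π̃`-reversible and
count-preserving, `|S| ≥ 2`, `Σ_{k≠0} μ_k(A)μ_k(Aᶜ) > 0`:
`Gap(P) ≤ (t·η + (1−t)·Σ_{k≠0} w_k·Q_k(A,Aᶜ))/Σ_{k≠0} μ_k(A)μ_k(Aᶜ)`. [ours] -/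
theorem handover_spectralGap_le
    (hA : 0 < ∑ k : Fin (K + 1), (if k = 0 then (0 : ℝ) else (∑ u ∈ A, μ k u) * ∑ u ∈ Aᶜ, μ k u)) :
    spectralGap (tensorFun μ) (fun x y : Fin (K + 1) → S => t * Q x y + (1 - t) * prodKernel w M x y)
      ≤ (t * edgeMeasure (tensorFun μ) Q (univ.filter (fun x : Fin (K + 1) → S => x 0 ∈ A))
              (univ.filter (fun x : Fin (K + 1) → S => x 0 ∈ A))ᶜ
          + (1 - t) * ∑ k, w k * (if k = 0 then (0 : ℝ) else edgeMeasure (μ k) (M k) A Aᶜ))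
        / ∑ k : Fin (K + 1), (if k = 0 then (0 : ℝ) else (∑ u ∈ A, μ k u) * ∑ u ∈ Aᶜ, μ k u) := by
  have hP := weightedScheme_isRowStochastic hQ hM hw0 hw1 ht0 ht1
  have hDB := weightedScheme_detailedBalance (w := w) hQrev hMrev t
  have hray := LevinPeres2017_lemma_13_7_rayleigh (tensorFun_pos hμ) (sum_tensorFun_eq_one μ hμ1) hP hDB
    (tensorFun_mean_coldCount (μ := μ) hμ1 A)
  rw [tensorFun_piInner_coldCount hμ1, weightedScheme_dirichletForm, exchange_dirichletForm_coldCount hμ1 hQA,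
    exchange_dirichletForm_hotIndicator hμ1 hQ hQrev, prodKernel_dirichletForm_coldCount hμ1 hM hMrev] at hray
  rw [le_div_iff₀ hA]
  exact hray

/-- **THE WEIGHTED TUNNELLING CEILING** (the weighted form of `ExchangeSchemeSectorCeiling`): with the full sector count
`G_A(x) = Σ_k f_A^{(μ_k)}(x_k)`, invisible to every count-preserving exchange move,
`Gap(P) ≤ (1−t)·Σ_k w_k·Q_k(A,Aᶜ)/Σ_k μ_k(A)μ_k(Aᶜ)` (`Σ_k μ_k(A)μ_k(Aᶜ) > 0`). [ours] -/
theorem weightedScheme_spectralGap_le_sectorCount (hA : 0 < ∑ k, (∑ u ∈ A, μ k u) * ∑ u ∈ Aᶜ, μ k u) :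
    spectralGap (tensorFun μ) (fun x y : Fin (K + 1) → S => t * Q x y + (1 - t) * prodKernel w M x y)
      ≤ (1 - t) * (∑ k, w k * edgeMeasure (μ k) (M k) A Aᶜ) / ∑ k, (∑ u ∈ A, μ k u) * ∑ u ∈ Aᶜ, μ k u := by
  have hP := weightedScheme_isRowStochastic hQ hM hw0 hw1 ht0 ht1
  have hDB := weightedScheme_detailedBalance (w := w) hQrev hMrev t
  -- the full count: mean zero, norm, the update's form, and INVISIBLE to `Q`
  have hmean : ∑ x : Fin (K + 1) → S, tensorFun μ x * ∑ k, bottleneckTestFun (μ k) A (x k) = 0 := by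
    rw [sum_tensorFun_mul_additive μ hμ1]
    exact Finset.sum_eq_zero fun k _ => sum_mul_bottleneckTestFun (μ k) A
  have hnorm : piInner (tensorFun μ) (fun x => ∑ k, bottleneckTestFun (μ k) A (x k))
      (fun x => ∑ k, bottleneckTestFun (μ k) A (x k)) = ∑ k, (∑ u ∈ A, μ k u) * ∑ u ∈ Aᶜ, μ k u := by
    rw [piInner_tensorFun_additive μ hμ1 (fun k => bottleneckTestFun (μ k) A)
      (fun k => sum_mul_bottleneckTestFun (μ k) A)]
    exact sum_congr rfl fun k _ => piInner_bottleneckTestFun (hμ1 k) A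
  have hupd : dirichletForm (tensorFun μ) (prodKernel w M) (fun x => ∑ k, bottleneckTestFun (μ k) A (x k))
      = ∑ k, w k * edgeMeasure (μ k) (M k) A Aᶜ := by
    rw [dirichletForm_prodKernel_additive μ hμ1 w M (fun k => bottleneckTestFun (μ k) A)]
    exact sum_congr rfl fun k _ => by
      rw [dirichletForm_bottleneckTestFun (hM k) ((hMrev k).isStationary (hM k).2) (hμ1 k) A]
  have hinv : dirichletForm (tensorFun μ) Q (fun x => ∑ k, bottleneckTestFun (μ k) A (x k))
      = dirichletForm (tensorFun μ) Q (fun _ => (0 : ℝ)) := by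
    refine dirichletForm_congr_support _ _ fun x y hxy => ?_
    have h := coldCount_sub_eq (μ := μ) hμ1 A x y
    -- full count = cold count + hot term
    have e : ∀ z : Fin (K + 1) → S, ∑ k, bottleneckTestFun (μ k) A (z k)
        = (∑ k, (if k = 0 then (0 : ℝ) else bottleneckTestFun (μ k) A (z k))) + bottleneckTestFun (μ 0) A (z 0) := by
      intro z
      rw [Fin.sum_univ_succ, Fin.sum_univ_succ, if_pos rfl, zero_add, add_comm]
      simp only [Fin.succ_ne_zero, if_false]
    rw [hQA x y hxy, sub_self, zero_sub] at h
    rw [e x, e y, sub_self, show ∀ a b c d : ℝ, a + b - (c + d) = (a - c) + (b - d) from fun a b c d => by ring, h,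
      bottleneckTestFun_eq (hμ1 0), bottleneckTestFun_eq (hμ1 0)]
    split_ifs <;> ring
  have hQ0 : dirichletForm (tensorFun μ) Q (fun _ : Fin (K + 1) → S => (0 : ℝ)) = 0 := by simp [dirichletForm]
  have hray := LevinPeres2017_lemma_13_7_rayleigh (tensorFun_pos hμ) (sum_tensorFun_eq_one μ hμ1) hP hDB hmean
  rw [hnorm, weightedScheme_dirichletForm, hinv, hQ0, hupd, mul_zero, zero_add] at hray
  rw [le_div_iff₀ hA]
  exact hray

/-! ### Sector-frozen cold replicas: `Q_k(A,Aᶜ) = 0` and `μ_k(A)μ_k(Aᶜ) ≥ v > 0` for `k ≠ 0`, `K ≥ 1` -/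

variable (hK : 1 ≤ K) {v : ℝ} (hvpos : 0 < v) (hv : ∀ k : Fin (K + 1), k ≠ 0 → v ≤ (∑ u ∈ A, μ k u) * ∑ u ∈ Aᶜ, μ k u)
  (hfrozen : ∀ k : Fin (K + 1), k ≠ 0 → edgeMeasure (μ k) (M k) A Aᶜ = 0)
include hK hvpos hv hfrozen

omit [Nontrivial S] hμ hμ1 hM hMrev hw0 hw1 ht0 ht1 hQ hQrev hQA hK hvpos hfrozen in
/-- `Σ_{k≠0} μ_k(A)μ_k(Aᶜ) ≥ K·v`. [ours] -/
theorem coldSectorMass_ge :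
    (K : ℝ) * v ≤ ∑ k : Fin (K + 1), (if k = 0 then (0 : ℝ) else (∑ u ∈ A, μ k u) * ∑ u ∈ Aᶜ, μ k u) := by
  rw [Fin.sum_univ_succ, if_pos rfl, zero_add]
  calc (K : ℝ) * v = ∑ _j : Fin K, v := by rw [Finset.sum_const, Finset.card_univ, Fintype.card_fin, nsmul_eq_mul]
    _ ≤ _ := sum_le_sum fun j _ => by rw [if_neg (Fin.succ_ne_zero j)]; exact hv j.succ (Fin.succ_ne_zero j)

/-- **SECTOR-FROZEN COLD REPLICAS: `Gap(P) ≤ t·η/(K·v)`** — `K` clients share the handovers, whatever the scheme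
and the update weights. [ours] -/
theorem handoverFrozen_spectralGap_le :
    spectralGap (tensorFun μ) (fun x y : Fin (K + 1) → S => t * Q x y + (1 - t) * prodKernel w M x y)
      ≤ t * edgeMeasure (tensorFun μ) Q (univ.filter (fun x : Fin (K + 1) → S => x 0 ∈ A))
            (univ.filter (fun x : Fin (K + 1) → S => x 0 ∈ A))ᶜ / (K * v) := by
  have hKpos : (0 : ℝ) < K := Nat.cast_pos.mpr (by omega)
  have hVge := coldSectorMass_ge hv
  have h := handover_spectralGap_le hμ hμ1 hM hMrev hw0 hw1 ht0 ht1 hQ hQrev hQA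
    (lt_of_lt_of_le (mul_pos hKpos hvpos) hVge)
  have hU0 : ∑ k, w k * (if k = 0 then (0 : ℝ) else edgeMeasure (μ k) (M k) A Aᶜ) = 0 :=
    Finset.sum_eq_zero fun k _ => by by_cases hk : k = 0 <;> simp [hk, hfrozen]
  rw [hU0, mul_zero, add_zero] at h
  have hη0 : 0 ≤ t * edgeMeasure (tensorFun μ) Q (univ.filter (fun x : Fin (K + 1) → S => x 0 ∈ A))
      (univ.filter (fun x : Fin (K + 1) → S => x 0 ∈ A))ᶜ :=
    mul_nonneg ht0 (edgeMeasure_nonneg (fun x => (tensorFun_pos hμ x).le) hQ.1 _ _)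
  exact h.trans (div_le_div_of_nonneg_left hη0 (by positivity) hVge)

/-- **THE LINEAR LAW: `Gap(P) ≤ t·min{μ_0(A), μ_0(Aᶜ)}/(K·v)`** with sector-frozen cold replicas — for every
count-preserving exchange move, every allocation `w` of the updates, and whatever the hot replica does. [ours] -/
theorem handoverFrozen_spectralGap_le_linear :
    spectralGap (tensorFun μ) (fun x y : Fin (K + 1) → S => t * Q x y + (1 - t) * prodKernel w M x y)
      ≤ t * min (∑ u ∈ A, μ 0 u) (∑ u ∈ Aᶜ, μ 0 u) / (K * v) := by
  have hKpos : (0 : ℝ) < K := Nat.cast_pos.mpr (by omega)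
  refine (handoverFrozen_spectralGap_le hμ hμ1 hM hMrev hw0 hw1 ht0 ht1 hQ hQrev hQA hK hvpos hv hfrozen).trans ?_
  refine div_le_div_of_nonneg_right (mul_le_mul_of_nonneg_left (le_min ?_ ?_) ht0) (by positivity)
  · exact handoverFlow_le_hot hμ hμ1 hQ A
  · exact handoverFlow_le_hot_compl hμ hμ1 hQ hQrev A

/-- **ONE TUNNELLING REPLICA, ANY UPDATE WEIGHTS: `Gap(P) ≤ (1−t)·w_0·Q_0(A,Aᶜ)/(K·v)`** with sector-frozen cold
replicas — fresh sector labels are minted at rate at most `w_0·Q_0(A,Aᶜ)` per update step and serve `K` clients.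
[ours] -/
theorem weightedSchemeFrozen_spectralGap_le_hot :
    spectralGap (tensorFun μ) (fun x y : Fin (K + 1) → S => t * Q x y + (1 - t) * prodKernel w M x y)
      ≤ (1 - t) * (w 0 * edgeMeasure (μ 0) (M 0) A Aᶜ) / (K * v) := by
  have hKpos : (0 : ℝ) < K := Nat.cast_pos.mpr (by omega)
  have hVge : (K : ℝ) * v ≤ ∑ k : Fin (K + 1), (∑ u ∈ A, μ k u) * ∑ u ∈ Aᶜ, μ k u := by
    refine (coldSectorMass_ge hv).trans (sum_le_sum fun k _ => ?_)
    split_ifs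
    · exact mul_nonneg (sum_nonneg fun u _ => (hμ _ u).le) (sum_nonneg fun u _ => (hμ _ u).le)
    · exact le_rfl
  have h := weightedScheme_spectralGap_le_sectorCount hμ hμ1 hM hMrev hw0 hw1 ht0 ht1 hQ hQrev hQA
    (lt_of_lt_of_le (mul_pos hKpos hvpos) hVge)
  have hsum : ∑ k : Fin (K + 1), w k * edgeMeasure (μ k) (M k) A Aᶜ = w 0 * edgeMeasure (μ 0) (M 0) A Aᶜ := by
    rw [Finset.sum_eq_single (0 : Fin (K + 1)) (fun k _ hk => by rw [hfrozen k hk, mul_zero])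
      (fun h => absurd (mem_univ _) h)]
  rw [hsum] at h
  have hnum : 0 ≤ (1 - t) * (w 0 * edgeMeasure (μ 0) (M 0) A Aᶜ) :=
    mul_nonneg (by linarith) (mul_nonneg (hw0 0) (edgeMeasure_nonneg (fun u => (hμ 0 u).le) (hM 0).1 A Aᶜ))
  exact h.trans (div_le_div_of_nonneg_left hnum (by positivity) hVge)

end Ceilings

end Summit.Ventures.LatticeQCDFlow.Scaling

end
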